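import Literature.LinearAlgebra.QuadraticForm.MaslovIndexTransverse
import Summits.Ventures.HSemireg.WedgeHankelRecurrenceInertiaRank

/-!
# Venture HSemireg — HERMITE'S SIGNATURE IS ADDITIVE OVER COPRIME FACTORISATIONS (Chinese remainder + Sylvester): for `m₁`, `m₂` monic COPRIME of degrees `e₁ + 1`, `e₂ + 1` over a LINEARLY ORDERED field,
# any residues `b₁`, `b₂` and any size `t + 1 ≥ deg(m₁m₂)`, **`sigPos H_t(b₁/m₁ + b₂/m₂) = sigPos H_{e₁}(b₁/m₁) + sigPos H_{e₂}(b₂/m₂)`** (same for `sigNeg` and `rank`); in particular for Hermite's weighted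
# symbols **`sigPos H_t(a·(m₁m₂)′/(m₁m₂)) = sigPos H_{e₁}(a·m₁′/m₁) + sigPos H_{e₂}(a·m₂′/m₂)`** — no roots, no splitting field, no real closure; and the INERTIA OF `H_t(b/m)` DOES NOT DEPEND ON THE SIZE
# `t + 1 ≥ deg m` (**`sigPos H_t(b/m) = sigPos H_{deg m − 1}(b/m)`**, any residue `b`)

HONEST FRAMING. Part of the Lean index of the computation cell `pub-hsemireg` (seat p10 gen 34, Sunday typer «UNIFORM-IN-n»).
LINEAR ALGEBRA OF QUADRATIC FORMS AND HANKEL (catalecticant) MATRICES over a field ONLY (Mathlib's `sigPos` ∕ `sigNeg`, `QuadraticMap.comp` ∕ `QuadraticMap.prod`, `Matrix.toQuadraticForm'`, `Polynomial.modByMonic`):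
no variety, no cohomology theory, no sheaf, no Ext group and no semiregularity map is constructed here; nothing here says that HC / HC_CM / HC_AV holds; no Literature fact is declared or used
(PROVED Literature `LinearAlgebra/QuadraticForm/MaslovIndexTransverse.sigPos_prod` ∕ `sigNeg_prod` — additivity of the inertia indices under `QuadraticMap.prod`, Garling §4.3 — is IMPORTED and used, not restated).
Custodian versions as in `WedgeHankelSiegelIdeal` (1/3).
SOURCE OF THE ARGUMENT (classical, cited not used): the trace ∕ Hermite form of `K[X]/(m₁m₂) ≅ K[X]/(m₁) × K[X]/(m₂)` (Chinese remainder) is the orthogonal sum of the two trace forms, and inertia indices add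
over orthogonal sums (Sylvester); over a real closed field the two sides are root counts (S. Basu, R. Pollack, M.-F. Roy, *Algorithms in Real Algebraic Geometry*, 2nd ed. 2006, §4.3.2 Thm. 4.57
«`Rank(Her(P,Q)) = #{x ∈ C | P(x) = 0 ∧ Q(x) ≠ 0}`, `Sign(Her(P,Q)) = TaQ(Q,P)`», obviously additive over coprime `P = P₁P₂`) and, in Hankel language, the Cauchy index of `b/m` (F. R. Gantmacher,
*The Theory of Matrices* II, Ch. XV §§ 3, 10–11: rank = number of poles, signature = Cauchy index — both additive over partial fractions with coprime denominators).  The statements below are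
the ROOT-FREE algebraic form over an arbitrary linearly ordered field, in the lineage's `dualSeq` ∕ `hankelSq` vocabulary, by PULL-BACK (N126 `sigPos_comp_eq_of_surjective`) instead of roots.
DEDUP DISCLOSURE (`rg` of the whole tree — all Summits ventures, Literature — and Mathlib, 2026-09-01): no statement of the additivity of `sigPos` ∕ `sigNeg` ∕ `rank` of Hankel or Hermite ∕ trace
forms over coprime factors or partial fractions exists (`rg 'IsCoprime'` ∩ `rg 'sigPos'`: two unrelated lattice files; Literature `CauchyIndex.lean` has BPR Thm. 2.58 ∕ Sturm, no Hankel form;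
`HankelRankRationalFunction.lean` has Gantmacher Thm. 8 (rank = number of poles) for ONE fraction; `TraceFormSignature` ∕ `HermiteForm` ∕ `HermiteRankSignature` count roots); the size-independence
of the inertia of `H_t(b/m)` is new as stated (the RANK half for large windows is Kronecker's theorem, N82 `WedgeHankelRecurrenceKronecker` ∕ Literature `HankelRecurrenceRank`, neither used here).
N118 `dualSeq_mul_derivative_mul` is the case `a = 1` of `dualSeq_mul_mul_derivative_mul` below (stated there for Newton sums; re-derived here in one line from N45 rather than imported).

WHAT IS IN THE TREE.  N18 (`WedgeHankelRecurrenceModule`): `hkFun K q s` (`⟪p, q⟫_s = Σ_i p_i q_{i+s}`, linear in `p`), `hkFun_monomial`.  N32 (`WedgeHankelRecurrenceDual`): `dualSeq K m b`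
(`j ↦ [X^{deg m − 1}](X^j b mod m)`, the coefficient sequence of `b/m`), `hkFun_dualSeq`.  N45 (`WedgeHankelRecurrenceSymbol`): `dualSeq_add_dualSeq` (`b₁/m₁ + b₂/m₂ = (b₁m₂ + b₂m₁)/(m₁m₂)`).
N46: `hankelSq K t q = (q_{i+j})_{i,j ≤ t}`.  N126 (`WedgeHankelRecurrenceInertia`): `toQuadraticForm'_hankelSq_apply`, **`sigPos_comp_eq_of_surjective`** ∕ `sigNeg_comp_eq_of_surjective`.  N132
(`WedgeHankelRecurrenceInertiaRank`): `rank_hankelSq_eq_sigPos_add_sigNeg`.  Mathlib: `Polynomial.modByMonic_eq_of_dvd_sub`, `modByMonic_eq_sub_mul_div`, `modByMonic_eq_self_iff`, `natDegree_modByMonic_lt`,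
`sum_modByMonic_coeff`, `degree_sum_fin_lt`, `as_sum_range'`, `Polynomial.modByMonicHom`, `Polynomial.lcoeff`, `LinearMap.pi` ∕ `LinearMap.proj` ∕ `LinearMap.prod`, `QuadraticMap.prod_apply`, `Function.prod_apply`.
THIS FILE (namespace `Summit.Ventures.HSemireg.Wedge.HankelOuter` continued; PLAIN on N132 (hence N126) + PROVED Literature `MaslovIndexTransverse`; 0 definitions — the reduction map
`v ↦ (coefficients of f_v mod m)`, `f_v = Σ_{i ≤ t} v_i X^i`, is written out as `LinearMap.pi (k ↦ lcoeff k ∘ modByMonicHom m ∘ Σ_i monomial i ∘ proj i)` where a statement needs it as a linear map):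
* §723 THE FORM OF A DUAL CLASS FACTORS THROUGH REDUCTION `mod m`: `toQuadraticForm'_hankelSq_eq_hkFun_sq` (**`vᵀ H_t(q) v = ⟪f_v², q⟫₀`**), `hkFun_dualSeq_zero`, `toQuadraticForm'_hankelSq_dualSeq_eq_coeff`
  (`vᵀ H_t(b/m) v = [X^{deg m−1}](f_v² b mod m)`), `sq_mul_modByMonic_eq`, bookkeeping `coeff_sum_monomial_fin` ∕ `degree_sum_monomial_fin_lt` ∕ `sum_monomial_coeff_eq_of_degree_lt`,
  **`toQuadraticForm'_hankelSq_dualSeq_eq_modByMonic`** (`vᵀ H_t(b/m) v = uᵀ H_e(b/m) u`, `u` = coefficients of `f_v mod m`, `deg m = e + 1`, ANY `t`), `pi_lcoeff_modByMonicHom_apply`,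
  `exists_coeff_modByMonic_eq` (the reduction map is onto for `deg m ≤ t + 1`), **`sigPos_hankelSq_dualSeq_eq_of_natDegree_le`** ∕ **`sigNeg_…`** ∕ `rank_…` (SIZE INDEPENDENCE, any residue `b`).
* §724 CHINESE REMAINDER: **`exists_coeff_modByMonic_eq_and_eq`** (the PAIR of reduction maps is onto `K^{e₁+1} × K^{e₂+1}` for coprime `m₁`, `m₂`, `deg(m₁m₂) ≤ t + 1`), `toQuadraticForm'_hankelSq_add`,
  **`toQuadraticForm'_hankelSq_dualSeq_add_eq_prod_comp`** (`H_t(b₁/m₁ + b₂/m₂)` is the pull-back of the orthogonal sum `H_{e₁}(b₁/m₁) ⊥ H_{e₂}(b₂/m₂)`; any field, no coprimality),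
  **`sigPos_hankelSq_dualSeq_add_of_isCoprime`** ∕ **`sigNeg_hankelSq_dualSeq_add_of_isCoprime`** ∕ **`rank_hankelSq_dualSeq_add_of_isCoprime`** (THE ADDITIVITY), `sigPos/sigNeg_hankelSq_dualSeq_mul_of_isCoprime`
  (the dual class `(b₁m₂ + b₂m₁)/(m₁m₂)`), `sigPos/sigNeg_hankelSq_dualSeq_mul_of_eq_one` (ANY residue `b` of `m₁m₂`, split by `c₁m₁ + c₂m₂ = 1`: `b/(m₁m₂) = b c₂/m₁ + b c₁/m₂`).
* §725 HERMITE'S FORMS: `dualSeq_mul_mul_derivative_mul` (`a(m₁m₂)′/(m₁m₂) = a m₁′/m₁ + a m₂′/m₂`, any monic `m₁`, `m₂`), `hankelSq_dualSeq_mul_mul_derivative_mul` (the matrices add),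
  **`sigPos_hankelSq_dualSeq_mul_derivative_of_isCoprime`** ∕ **`sigNeg_…`** ∕ `sigPos_sub_sigNeg_…` (signatures add) ∕ **`rank_…`**, `sigPos_sigNeg_hankelSq_dualSeq_derivative_of_isCoprime` (`a = 1`),
  `sigNeg_hankelSq_dualSeq_mul_derivative_eq_of_sigNeg_eq_zero` (a factor without negative squares is invisible to `sigNeg`).
CAVEATS.  `m₁`, `m₂` MONIC (the lineage's `dualSeq` uses `%ₘ`); sizes are `eᵢ + 1 = deg mᵢ` on the right (any larger size by §723) and any `t + 1 ≥ deg(m₁m₂)` on the left — for `t + 1 < deg(m₁m₂)` the pair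
of reduction maps is not onto and additivity FAILS in general (e.g. `t = 0`: `H_0` is the `1 × 1` matrix `(q_0)` and `sigPos (q₁(0) + q₂(0)) ≤ 1`); coprimality is needed (for `m₁ = m₂ = X`, `b₁ = b₂ = 1`
over `ℚ`: `H_1(1/X + 1/X) = (2 0; 0 0)` has `sigPos = 1 ≠ 1 + 1`).  The `rank` statements are over ORDERED fields only (via N132); the any-field rank additivity is not typed here.
Nothing Ext-side.  New names only.
-/

open Module Polynomial
open scoped Matrix Polynomial

namespace Summit.Ventures.HSemireg.Wedge.HankelOuter

open Summit.Ventures.HSemireg.Wedge Summit.Ventures.HSemireg.Wedge.Hankel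

variable (K : Type*) [Field K]

/-! ## §723. The Hankel form is a Hankel functional; the form of a dual class `b/m` factors through reduction `mod m` -/

/-- **`vᵀ H_t(q) v = ⟪f_v², q⟫₀`** where `f_v = Σ_i v_i X^i` is the polynomial with coefficient vector `v` and `⟪p, q⟫₀ = Σ_k p_k q_k` is N18's Hankel functional: the Hankel quadratic form is the
functional `q` evaluated on SQUARES. [this file, §723] -/
theorem toQuadraticForm'_hankelSq_eq_hkFun_sq (t : ℕ) (q : ℕ → K) (v : Fin (t + 1) → K) :
    (hankelSq K t q).toQuadraticForm' v = hkFun K q 0 ((∑ i : Fin (t + 1), monomial (i : ℕ) (v i)) ^ 2) := by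
  rw [toQuadraticForm'_hankelSq_apply, sq, Finset.sum_mul_sum, map_sum]
  refine Finset.sum_congr rfl fun i _ => ?_
  rw [map_sum]
  refine Finset.sum_congr rfl fun j _ => ?_
  rw [monomial_mul_monomial, hkFun_monomial, add_zero, mul_comm]

/-- `⟪p, dualSeq m b⟫₀ = [X^{deg m − 1}] (p · b mod m)` (N32's `hkFun_dualSeq` at shift `0`). [this file, §723] -/
theorem hkFun_dualSeq_zero (m b p : K[X]) : hkFun K (dualSeq K m b) 0 p = ((p * b) %ₘ m).coeff (m.natDegree - 1) := by
  rw [hkFun_dualSeq, pow_zero, one_mul]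

/-- **The Hankel form of a dual class: `vᵀ H_t(b/m) v = [X^{deg m − 1}] (f_v² · b mod m)`.** [this file, §723] -/
theorem toQuadraticForm'_hankelSq_dualSeq_eq_coeff (m b : K[X]) (t : ℕ) (v : Fin (t + 1) → K) :
    (hankelSq K t (dualSeq K m b)).toQuadraticForm' v = (((∑ i : Fin (t + 1), monomial (i : ℕ) (v i)) ^ 2 * b) %ₘ m).coeff (m.natDegree - 1) := by
  rw [toQuadraticForm'_hankelSq_eq_hkFun_sq, hkFun_dualSeq_zero]

variable {K} in
/-- `(f² · b) mod m = ((f mod m)² · b) mod m` (`m` monic). [this file, §723] -/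
theorem sq_mul_modByMonic_eq {m : K[X]} (hm : m.Monic) (f b : K[X]) : (f ^ 2 * b) %ₘ m = ((f %ₘ m) ^ 2 * b) %ₘ m := by
  refine Polynomial.modByMonic_eq_of_dvd_sub hm ?_
  have hd : m ∣ f - f %ₘ m := by
    rw [Polynomial.modByMonic_eq_sub_mul_div f m, sub_sub_cancel]
    exact dvd_mul_right m _
  rw [show f ^ 2 * b - (f %ₘ m) ^ 2 * b = (f - f %ₘ m) * ((f + f %ₘ m) * b) by ring]
  exact hd.mul_right _

/-- The coefficients of `f_v = Σ_{i ≤ t} v_i X^i` are `v`. [bookkeeping] -/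
theorem coeff_sum_monomial_fin (n : ℕ) (v : Fin n → K) (k : Fin n) : (∑ i : Fin n, monomial (i : ℕ) (v i)).coeff (k : ℕ) = v k := by
  rw [finsetSum_coeff, Finset.sum_eq_single k]
  · rw [coeff_monomial, if_pos rfl]
  · intro i _ hik
    rw [coeff_monomial, if_neg fun h => hik (Fin.ext h)]
  · intro h
    exact absurd (Finset.mem_univ k) h

/-- `deg f_v < n` for `v ∈ K^n`. [bookkeeping] -/
theorem degree_sum_monomial_fin_lt (n : ℕ) (v : Fin n → K) : (∑ i : Fin n, monomial (i : ℕ) (v i)).degree < n := by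
  have h := Polynomial.degree_sum_fin_lt v
  simp_rw [Polynomial.C_mul_X_pow_eq_monomial] at h
  exact h

/-- A polynomial of degree `< n` is `f_v` for its own coefficient vector. [bookkeeping; Mathlib `as_sum_range'`] -/
theorem sum_monomial_coeff_eq_of_degree_lt {n : ℕ} {g : K[X]} (hg : g.degree < n) : ∑ i : Fin n, monomial (i : ℕ) (g.coeff i) = g := by
  by_cases h0 : g = 0
  · subst h0
    exact Finset.sum_eq_zero fun i _ => by rw [coeff_zero, map_zero]
  · rw [Fin.sum_univ_eq_sum_range (fun i => monomial i (g.coeff i)) n]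
    exact (Polynomial.as_sum_range' g n ((Polynomial.natDegree_lt_iff_degree_lt h0).2 hg)).symm

/-- **The form of `b/m` at size `t + 1` is the form at size `deg m` evaluated on the residue: `vᵀ H_t(b/m) v = uᵀ H_e(b/m) u` with `u` the coefficient vector of `f_v mod m`** (`deg m = e + 1`; any `t`,
also `t < e`). [this file, §723] -/
theorem toQuadraticForm'_hankelSq_dualSeq_eq_modByMonic {e : ℕ} {m : K[X]} (hm : m.Monic) (hmd : m.natDegree = e + 1) (b : K[X]) (t : ℕ) (v : Fin (t + 1) → K) :
    (hankelSq K t (dualSeq K m b)).toQuadraticForm' v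
      = (hankelSq K e (dualSeq K m b)).toQuadraticForm' fun k : Fin (e + 1) => ((∑ i : Fin (t + 1), monomial (i : ℕ) (v i)) %ₘ m).coeff k := by
  rw [toQuadraticForm'_hankelSq_dualSeq_eq_coeff, toQuadraticForm'_hankelSq_dualSeq_eq_coeff, sq_mul_modByMonic_eq hm (∑ i : Fin (t + 1), monomial (i : ℕ) (v i))]
  have hdeg : m.degree ≤ (e + 1 : ℕ) := by rw [Polynomial.degree_eq_natDegree hm.ne_zero, hmd]
  rw [Polynomial.sum_modByMonic_coeff hm hdeg]

/-- The reduction map `v ↦ coefficient vector of (f_v mod m)` as a linear map `K^{t+1} → K^{e+1}`, with its value. [bookkeeping] -/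
theorem pi_lcoeff_modByMonicHom_apply (m : K[X]) (e t : ℕ) (v : Fin (t + 1) → K) :
    LinearMap.pi (fun k : Fin (e + 1) => (lcoeff K (k : ℕ)) ∘ₗ m.modByMonicHom ∘ₗ (∑ i : Fin (t + 1), (monomial (i : ℕ)) ∘ₗ LinearMap.proj i)) v
      = fun k : Fin (e + 1) => ((∑ i : Fin (t + 1), monomial (i : ℕ) (v i)) %ₘ m).coeff k := by
  funext k
  rw [LinearMap.pi_apply, LinearMap.comp_apply, LinearMap.comp_apply, lcoeff_apply, Polynomial.modByMonicHom_apply, LinearMap.sum_apply]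
  simp only [LinearMap.comp_apply, LinearMap.proj_apply]

/-- **The reduction map is onto for `deg m ≤ t + 1`**: every `u ∈ K^{e+1}` is the coefficient vector of `f_v mod m` for some `v ∈ K^{t+1}` (take `f_v = f_u`, already reduced). [this file, §723] -/
theorem exists_coeff_modByMonic_eq {e t : ℕ} {m : K[X]} (hm : m.Monic) (hmd : m.natDegree = e + 1) (ht : e + 1 ≤ t + 1) (u : Fin (e + 1) → K) :
    ∃ v : Fin (t + 1) → K, (fun k : Fin (e + 1) => ((∑ i : Fin (t + 1), monomial (i : ℕ) (v i)) %ₘ m).coeff k) = u := by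
  set g : K[X] := ∑ i : Fin (e + 1), monomial (i : ℕ) (u i) with hg
  have hgd : g.degree < (e + 1 : ℕ) := degree_sum_monomial_fin_lt K (e + 1) u
  have hgt : g.degree < (t + 1 : ℕ) := hgd.trans_le (by exact_mod_cast ht)
  refine ⟨fun i => g.coeff i, funext fun k => ?_⟩
  have hself : g %ₘ m = g := (Polynomial.modByMonic_eq_self_iff hm).2 (by rwa [Polynomial.degree_eq_natDegree hm.ne_zero, hmd])
  simp only
  rw [sum_monomial_coeff_eq_of_degree_lt K hgt, hself, hg, coeff_sum_monomial_fin]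

section Ordered

variable {K} [LinearOrder K]

/-- **SIZE INDEPENDENCE OF THE INERTIA OF `H_t(b/m)`: for `m` monic of degree `e + 1 ≤ t + 1` and ANY residue `b`, `sigPos H_t(b/m) = sigPos H_e(b/m)`** — the form at any admissible size is the
pull-back of the form at size `deg m` along the (onto) reduction map (N126 `sigPos_comp_eq_of_surjective`). No splitting, no separability, any linearly ordered field. [this file, §723] -/
theorem sigPos_hankelSq_dualSeq_eq_of_natDegree_le {e t : ℕ} {m : K[X]} (hm : m.Monic) (hmd : m.natDegree = e + 1) (ht : e + 1 ≤ t + 1) (b : K[X]) :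
    sigPos (hankelSq K t (dualSeq K m b)).toQuadraticForm' = sigPos (hankelSq K e (dualSeq K m b)).toQuadraticForm' := by
  set R := LinearMap.pi (fun k : Fin (e + 1) => (lcoeff K (k : ℕ)) ∘ₗ m.modByMonicHom ∘ₗ (∑ i : Fin (t + 1), (monomial (i : ℕ)) ∘ₗ LinearMap.proj i)) with hR
  have hcomp : (hankelSq K t (dualSeq K m b)).toQuadraticForm' = (hankelSq K e (dualSeq K m b)).toQuadraticForm'.comp R := by
    ext v
    rw [QuadraticMap.comp_apply, hR, pi_lcoeff_modByMonicHom_apply, toQuadraticForm'_hankelSq_dualSeq_eq_modByMonic K hm hmd]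
  have hsurj : Function.Surjective R := fun u => by
    obtain ⟨v, hv⟩ := exists_coeff_modByMonic_eq K hm hmd ht u
    exact ⟨v, by rw [hR, pi_lcoeff_modByMonicHom_apply, hv]⟩
  rw [hcomp, sigPos_comp_eq_of_surjective _ hsurj]

/-- **… and `sigNeg H_t(b/m) = sigNeg H_e(b/m)`.** [this file, §723] -/
theorem sigNeg_hankelSq_dualSeq_eq_of_natDegree_le {e t : ℕ} {m : K[X]} (hm : m.Monic) (hmd : m.natDegree = e + 1) (ht : e + 1 ≤ t + 1) (b : K[X]) :
    sigNeg (hankelSq K t (dualSeq K m b)).toQuadraticForm' = sigNeg (hankelSq K e (dualSeq K m b)).toQuadraticForm' := by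
  set R := LinearMap.pi (fun k : Fin (e + 1) => (lcoeff K (k : ℕ)) ∘ₗ m.modByMonicHom ∘ₗ (∑ i : Fin (t + 1), (monomial (i : ℕ)) ∘ₗ LinearMap.proj i)) with hR
  have hcomp : (hankelSq K t (dualSeq K m b)).toQuadraticForm' = (hankelSq K e (dualSeq K m b)).toQuadraticForm'.comp R := by
    ext v
    rw [QuadraticMap.comp_apply, hR, pi_lcoeff_modByMonicHom_apply, toQuadraticForm'_hankelSq_dualSeq_eq_modByMonic K hm hmd]
  have hsurj : Function.Surjective R := fun u => by
    obtain ⟨v, hv⟩ := exists_coeff_modByMonic_eq K hm hmd ht u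
    exact ⟨v, by rw [hR, pi_lcoeff_modByMonicHom_apply, hv]⟩
  rw [hcomp, sigNeg_comp_eq_of_surjective _ hsurj]

variable [IsStrictOrderedRing K]

/-- **… hence `rank H_t(b/m) = rank H_e(b/m)` over an ordered field** (N132 `rank = sigPos + sigNeg`; over any field this is the rank half of Kronecker's theorem, N82 ∕ Literature `HankelRankRationalFunction`, not used here). [this file, §723] -/
theorem rank_hankelSq_dualSeq_eq_of_natDegree_le {e t : ℕ} {m : K[X]} (hm : m.Monic) (hmd : m.natDegree = e + 1) (ht : e + 1 ≤ t + 1) (b : K[X]) :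
    (hankelSq K t (dualSeq K m b)).rank = (hankelSq K e (dualSeq K m b)).rank := by
  rw [rank_hankelSq_eq_sigPos_add_sigNeg, rank_hankelSq_eq_sigPos_add_sigNeg, sigPos_hankelSq_dualSeq_eq_of_natDegree_le hm hmd ht, sigNeg_hankelSq_dualSeq_eq_of_natDegree_le hm hmd ht]

end Ordered

/-! ## §724. CHINESE REMAINDER: for coprime monic `m₁`, `m₂` the Hankel form of `b₁/m₁ + b₂/m₂` is the orthogonal sum of the two forms, pulled back along the (onto) pair of reduction maps -/

/-- **The pair of reduction maps `v ↦ (f_v mod m₁, f_v mod m₂)` is ONTO `K^{e₁+1} × K^{e₂+1}` when `m₁`, `m₂` are coprime monic of degrees `e₁ + 1`, `e₂ + 1` and `deg(m₁m₂) ≤ t + 1`** (Chinese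
remainder theorem: with `c₁m₁ + c₂m₂ = 1`, `f = (g₁c₂m₂ + g₂c₁m₁) mod m₁m₂` has degree `< deg(m₁m₂) ≤ t + 1` and residues `g₁`, `g₂`). [this file, §724] -/
theorem exists_coeff_modByMonic_eq_and_eq {e₁ e₂ t : ℕ} {m₁ m₂ : K[X]} (hm₁ : m₁.Monic) (hm₂ : m₂.Monic) (hc : IsCoprime m₁ m₂) (hd₁ : m₁.natDegree = e₁ + 1) (hd₂ : m₂.natDegree = e₂ + 1)
    (ht : e₁ + e₂ + 2 ≤ t + 1) (u₁ : Fin (e₁ + 1) → K) (u₂ : Fin (e₂ + 1) → K) :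
    ∃ v : Fin (t + 1) → K, (fun k : Fin (e₁ + 1) => ((∑ i : Fin (t + 1), monomial (i : ℕ) (v i)) %ₘ m₁).coeff k) = u₁
      ∧ (fun k : Fin (e₂ + 1) => ((∑ i : Fin (t + 1), monomial (i : ℕ) (v i)) %ₘ m₂).coeff k) = u₂ := by
  obtain ⟨c₁, c₂, hcc⟩ := hc
  set g₁ : K[X] := ∑ i : Fin (e₁ + 1), monomial (i : ℕ) (u₁ i) with hg₁
  set g₂ : K[X] := ∑ i : Fin (e₂ + 1), monomial (i : ℕ) (u₂ i) with hg₂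
  set h : K[X] := g₁ * (c₂ * m₂) + g₂ * (c₁ * m₁) with hh
  set f : K[X] := h %ₘ (m₁ * m₂) with hf
  have hm : (m₁ * m₂).Monic := hm₁.mul hm₂
  have hmd : (m₁ * m₂).natDegree = e₁ + e₂ + 2 := by rw [hm₁.natDegree_mul hm₂, hd₁, hd₂]; ring
  have hm1 : m₁ * m₂ ≠ 1 := fun h1 => by have := congrArg natDegree h1; rw [hmd, natDegree_one] at this; omega
  have hft : f.degree < (t + 1 : ℕ) := by
    by_cases hf0 : f = 0
    · rw [hf0, degree_zero]; exact WithBot.bot_lt_coe _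
    · rw [Polynomial.degree_eq_natDegree hf0]
      have := Polynomial.natDegree_modByMonic_lt h hm hm1
      exact_mod_cast (show f.natDegree < t + 1 by rw [hf]; omega)
  have hself₁ : g₁ %ₘ m₁ = g₁ :=
    (Polynomial.modByMonic_eq_self_iff hm₁).2 (by rw [Polynomial.degree_eq_natDegree hm₁.ne_zero, hd₁]; exact degree_sum_monomial_fin_lt K (e₁ + 1) u₁)
  have hself₂ : g₂ %ₘ m₂ = g₂ :=
    (Polynomial.modByMonic_eq_self_iff hm₂).2 (by rw [Polynomial.degree_eq_natDegree hm₂.ne_zero, hd₂]; exact degree_sum_monomial_fin_lt K (e₂ + 1) u₂)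
  -- `f ≡ h (mod mᵢ)` because `mᵢ ∣ m₁m₂ ∣ h − f`
  have hfh : m₁ * m₂ ∣ h - f := by
    rw [hf, Polynomial.modByMonic_eq_sub_mul_div h (m₁ * m₂), sub_sub_cancel]
    exact dvd_mul_right _ _
  have hf₁ : f %ₘ m₁ = g₁ := by
    rw [← Polynomial.modByMonic_eq_of_dvd_sub hm₁ ((dvd_mul_right m₁ m₂).trans hfh)]
    rw [Polynomial.modByMonic_eq_of_dvd_sub hm₁ (p₂ := g₁) ?_, hself₁]
    rw [hh, show g₁ * (c₂ * m₂) + g₂ * (c₁ * m₁) - g₁ = m₁ * (g₂ * c₁ - g₁ * c₁) + g₁ * (c₁ * m₁ + c₂ * m₂ - 1) by ring, hcc, sub_self, mul_zero, add_zero]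
    exact dvd_mul_right _ _
  have hf₂ : f %ₘ m₂ = g₂ := by
    rw [← Polynomial.modByMonic_eq_of_dvd_sub hm₂ ((dvd_mul_left m₂ m₁).trans hfh)]
    rw [Polynomial.modByMonic_eq_of_dvd_sub hm₂ (p₂ := g₂) ?_, hself₂]
    rw [hh, show g₁ * (c₂ * m₂) + g₂ * (c₁ * m₁) - g₂ = m₂ * (g₁ * c₂ - g₂ * c₂) + g₂ * (c₁ * m₁ + c₂ * m₂ - 1) by ring, hcc, sub_self, mul_zero, add_zero]
    exact dvd_mul_right _ _
  refine ⟨fun i => f.coeff i, funext fun k => ?_, funext fun k => ?_⟩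
  · simp only
    rw [sum_monomial_coeff_eq_of_degree_lt K hft, hf₁, hg₁, coeff_sum_monomial_fin]
  · simp only
    rw [sum_monomial_coeff_eq_of_degree_lt K hft, hf₂, hg₂, coeff_sum_monomial_fin]

/-- `H_t(q₁ + q₂) = H_t(q₁) + H_t(q₂)` as quadratic forms. [bookkeeping] -/
theorem toQuadraticForm'_hankelSq_add (t : ℕ) (q₁ q₂ : ℕ → K) :
    (hankelSq K t (q₁ + q₂)).toQuadraticForm' = (hankelSq K t q₁).toQuadraticForm' + (hankelSq K t q₂).toQuadraticForm' := by
  ext v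
  rw [QuadraticMap.add_apply, toQuadraticForm'_hankelSq_apply, toQuadraticForm'_hankelSq_apply, toQuadraticForm'_hankelSq_apply, ← Finset.sum_add_distrib]
  refine Finset.sum_congr rfl fun i _ => ?_
  rw [← Finset.sum_add_distrib]
  refine Finset.sum_congr rfl fun j _ => ?_
  rw [Pi.add_apply, add_mul]

/-- **The Hankel form of `b₁/m₁ + b₂/m₂` is the pull-back of the ORTHOGONAL SUM `H_{e₁}(b₁/m₁) ⊥ H_{e₂}(b₂/m₂)` along the pair of reduction maps** (`mᵢ` monic of degree `eᵢ + 1`; any `t`, any field; no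
coprimality needed for the identity itself). [this file, §724] -/
theorem toQuadraticForm'_hankelSq_dualSeq_add_eq_prod_comp {e₁ e₂ : ℕ} {m₁ m₂ : K[X]} (hm₁ : m₁.Monic) (hm₂ : m₂.Monic) (hd₁ : m₁.natDegree = e₁ + 1) (hd₂ : m₂.natDegree = e₂ + 1) (b₁ b₂ : K[X]) (t : ℕ) :
    (hankelSq K t (dualSeq K m₁ b₁ + dualSeq K m₂ b₂)).toQuadraticForm'
      = ((hankelSq K e₁ (dualSeq K m₁ b₁)).toQuadraticForm'.prod (hankelSq K e₂ (dualSeq K m₂ b₂)).toQuadraticForm').comp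
          ((LinearMap.pi (fun k : Fin (e₁ + 1) => (lcoeff K (k : ℕ)) ∘ₗ m₁.modByMonicHom ∘ₗ (∑ i : Fin (t + 1), (monomial (i : ℕ)) ∘ₗ LinearMap.proj i))).prod
           (LinearMap.pi (fun k : Fin (e₂ + 1) => (lcoeff K (k : ℕ)) ∘ₗ m₂.modByMonicHom ∘ₗ (∑ i : Fin (t + 1), (monomial (i : ℕ)) ∘ₗ LinearMap.proj i)))) := by
  ext v
  rw [toQuadraticForm'_hankelSq_add, QuadraticMap.add_apply, QuadraticMap.comp_apply]
  simp only [LinearMap.prod_apply, Function.prod_apply, QuadraticMap.prod_apply]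
  rw [pi_lcoeff_modByMonicHom_apply, pi_lcoeff_modByMonicHom_apply, toQuadraticForm'_hankelSq_dualSeq_eq_modByMonic K hm₁ hd₁, toQuadraticForm'_hankelSq_dualSeq_eq_modByMonic K hm₂ hd₂]

section OrderedCRT

variable {K} [LinearOrder K] [IsStrictOrderedRing K]

/-- **INERTIA IS ADDITIVE OVER PARTIAL FRACTIONS WITH COPRIME DENOMINATORS, positive index: for `m₁`, `m₂` monic coprime of degrees `e₁ + 1`, `e₂ + 1` over a linearly ordered field, any residues
`b₁`, `b₂` and any size `t + 1 ≥ deg(m₁ m₂)`, `sigPos H_t(b₁/m₁ + b₂/m₂) = sigPos H_{e₁}(b₁/m₁) + sigPos H_{e₂}(b₂/m₂)`** (pull-back along an onto map, N126, of an orthogonal sum, PROVED Literature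
`MaslovIndexTransverse.sigPos_prod`). [this file, §724] -/
theorem sigPos_hankelSq_dualSeq_add_of_isCoprime {e₁ e₂ t : ℕ} {m₁ m₂ : K[X]} (hm₁ : m₁.Monic) (hm₂ : m₂.Monic) (hc : IsCoprime m₁ m₂) (hd₁ : m₁.natDegree = e₁ + 1) (hd₂ : m₂.natDegree = e₂ + 1)
    (ht : e₁ + e₂ + 2 ≤ t + 1) (b₁ b₂ : K[X]) :
    sigPos (hankelSq K t (dualSeq K m₁ b₁ + dualSeq K m₂ b₂)).toQuadraticForm'
      = sigPos (hankelSq K e₁ (dualSeq K m₁ b₁)).toQuadraticForm' + sigPos (hankelSq K e₂ (dualSeq K m₂ b₂)).toQuadraticForm' := by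
  rw [toQuadraticForm'_hankelSq_dualSeq_add_eq_prod_comp K hm₁ hm₂ hd₁ hd₂ b₁ b₂ t, sigPos_comp_eq_of_surjective _ ?_, Literature.LinearAlgebra.QuadraticForm.sigPos_prod]
  rintro ⟨u₁, u₂⟩
  obtain ⟨v, hv₁, hv₂⟩ := exists_coeff_modByMonic_eq_and_eq K hm₁ hm₂ hc hd₁ hd₂ ht u₁ u₂
  exact ⟨v, by rw [LinearMap.prod_apply, Function.prod_apply, pi_lcoeff_modByMonicHom_apply, pi_lcoeff_modByMonicHom_apply, hv₁, hv₂]⟩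

/-- **Negative index: `sigNeg H_t(b₁/m₁ + b₂/m₂) = sigNeg H_{e₁}(b₁/m₁) + sigNeg H_{e₂}(b₂/m₂)`** (same hypotheses). [this file, §724] -/
theorem sigNeg_hankelSq_dualSeq_add_of_isCoprime {e₁ e₂ t : ℕ} {m₁ m₂ : K[X]} (hm₁ : m₁.Monic) (hm₂ : m₂.Monic) (hc : IsCoprime m₁ m₂) (hd₁ : m₁.natDegree = e₁ + 1) (hd₂ : m₂.natDegree = e₂ + 1)
    (ht : e₁ + e₂ + 2 ≤ t + 1) (b₁ b₂ : K[X]) :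
    sigNeg (hankelSq K t (dualSeq K m₁ b₁ + dualSeq K m₂ b₂)).toQuadraticForm'
      = sigNeg (hankelSq K e₁ (dualSeq K m₁ b₁)).toQuadraticForm' + sigNeg (hankelSq K e₂ (dualSeq K m₂ b₂)).toQuadraticForm' := by
  rw [toQuadraticForm'_hankelSq_dualSeq_add_eq_prod_comp K hm₁ hm₂ hd₁ hd₂ b₁ b₂ t, sigNeg_comp_eq_of_surjective _ ?_, Literature.LinearAlgebra.QuadraticForm.sigNeg_prod]
  rintro ⟨u₁, u₂⟩
  obtain ⟨v, hv₁, hv₂⟩ := exists_coeff_modByMonic_eq_and_eq K hm₁ hm₂ hc hd₁ hd₂ ht u₁ u₂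
  exact ⟨v, by rw [LinearMap.prod_apply, Function.prod_apply, pi_lcoeff_modByMonicHom_apply, pi_lcoeff_modByMonicHom_apply, hv₁, hv₂]⟩

/-- **Rank: `rank H_t(b₁/m₁ + b₂/m₂) = rank H_{e₁}(b₁/m₁) + rank H_{e₂}(b₂/m₂)`** over an ordered field (N132). [this file, §724] -/
theorem rank_hankelSq_dualSeq_add_of_isCoprime {e₁ e₂ t : ℕ} {m₁ m₂ : K[X]} (hm₁ : m₁.Monic) (hm₂ : m₂.Monic) (hc : IsCoprime m₁ m₂) (hd₁ : m₁.natDegree = e₁ + 1) (hd₂ : m₂.natDegree = e₂ + 1)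
    (ht : e₁ + e₂ + 2 ≤ t + 1) (b₁ b₂ : K[X]) :
    (hankelSq K t (dualSeq K m₁ b₁ + dualSeq K m₂ b₂)).rank = (hankelSq K e₁ (dualSeq K m₁ b₁)).rank + (hankelSq K e₂ (dualSeq K m₂ b₂)).rank := by
  rw [rank_hankelSq_eq_sigPos_add_sigNeg, rank_hankelSq_eq_sigPos_add_sigNeg, rank_hankelSq_eq_sigPos_add_sigNeg, sigPos_hankelSq_dualSeq_add_of_isCoprime hm₁ hm₂ hc hd₁ hd₂ ht,
    sigNeg_hankelSq_dualSeq_add_of_isCoprime hm₁ hm₂ hc hd₁ hd₂ ht]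
  ring

/-- **The same for ONE dual class of the product read through its partial fractions: `sigPos H_t((b₁m₂ + b₂m₁)/(m₁m₂)) = sigPos H_{e₁}(b₁/m₁) + sigPos H_{e₂}(b₂/m₂)`** (N45 `dualSeq_add_dualSeq`:
`b₁/m₁ + b₂/m₂ = (b₁m₂ + b₂m₁)/(m₁m₂)`; every residue `b` mod `m₁m₂` has this shape, `bᵢ = b·cⱼ` from `c₁m₁ + c₂m₂ = 1`). [this file, §724] -/
theorem sigPos_hankelSq_dualSeq_mul_of_isCoprime {e₁ e₂ t : ℕ} {m₁ m₂ : K[X]} (hm₁ : m₁.Monic) (hm₂ : m₂.Monic) (hc : IsCoprime m₁ m₂) (hd₁ : m₁.natDegree = e₁ + 1) (hd₂ : m₂.natDegree = e₂ + 1)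
    (ht : e₁ + e₂ + 2 ≤ t + 1) (b₁ b₂ : K[X]) :
    sigPos (hankelSq K t (dualSeq K (m₁ * m₂) (b₁ * m₂ + b₂ * m₁))).toQuadraticForm'
      = sigPos (hankelSq K e₁ (dualSeq K m₁ b₁)).toQuadraticForm' + sigPos (hankelSq K e₂ (dualSeq K m₂ b₂)).toQuadraticForm' := by
  rw [← dualSeq_add_dualSeq K hm₁ hm₂, sigPos_hankelSq_dualSeq_add_of_isCoprime hm₁ hm₂ hc hd₁ hd₂ ht]

/-- `sigNeg` version of the previous statement. [this file, §724] -/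
theorem sigNeg_hankelSq_dualSeq_mul_of_isCoprime {e₁ e₂ t : ℕ} {m₁ m₂ : K[X]} (hm₁ : m₁.Monic) (hm₂ : m₂.Monic) (hc : IsCoprime m₁ m₂) (hd₁ : m₁.natDegree = e₁ + 1) (hd₂ : m₂.natDegree = e₂ + 1)
    (ht : e₁ + e₂ + 2 ≤ t + 1) (b₁ b₂ : K[X]) :
    sigNeg (hankelSq K t (dualSeq K (m₁ * m₂) (b₁ * m₂ + b₂ * m₁))).toQuadraticForm'
      = sigNeg (hankelSq K e₁ (dualSeq K m₁ b₁)).toQuadraticForm' + sigNeg (hankelSq K e₂ (dualSeq K m₂ b₂)).toQuadraticForm' := by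
  rw [← dualSeq_add_dualSeq K hm₁ hm₂, sigNeg_hankelSq_dualSeq_add_of_isCoprime hm₁ hm₂ hc hd₁ hd₂ ht]

/-- **Every residue of a coprime product splits: given `c₁m₁ + c₂m₂ = 1`, `sigPos H_t(b/(m₁m₂)) = sigPos H_{e₁}(b·c₂/m₁) + sigPos H_{e₂}(b·c₁/m₂)`.** [this file, §724] -/
theorem sigPos_hankelSq_dualSeq_mul_of_eq_one {e₁ e₂ t : ℕ} {m₁ m₂ c₁ c₂ : K[X]} (hm₁ : m₁.Monic) (hm₂ : m₂.Monic) (hcc : c₁ * m₁ + c₂ * m₂ = 1) (hd₁ : m₁.natDegree = e₁ + 1) (hd₂ : m₂.natDegree = e₂ + 1)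
    (ht : e₁ + e₂ + 2 ≤ t + 1) (b : K[X]) :
    sigPos (hankelSq K t (dualSeq K (m₁ * m₂) b)).toQuadraticForm'
      = sigPos (hankelSq K e₁ (dualSeq K m₁ (b * c₂))).toQuadraticForm' + sigPos (hankelSq K e₂ (dualSeq K m₂ (b * c₁))).toQuadraticForm' := by
  have hb : b = b * c₂ * m₂ + b * c₁ * m₁ := by
    calc b = b * (c₁ * m₁ + c₂ * m₂) := by rw [hcc, mul_one]
      _ = b * c₂ * m₂ + b * c₁ * m₁ := by ring
  conv_lhs => rw [hb]
  exact sigPos_hankelSq_dualSeq_mul_of_isCoprime hm₁ hm₂ ⟨c₁, c₂, hcc⟩ hd₁ hd₂ ht (b * c₂) (b * c₁)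

/-- `sigNeg` version. [this file, §724] -/
theorem sigNeg_hankelSq_dualSeq_mul_of_eq_one {e₁ e₂ t : ℕ} {m₁ m₂ c₁ c₂ : K[X]} (hm₁ : m₁.Monic) (hm₂ : m₂.Monic) (hcc : c₁ * m₁ + c₂ * m₂ = 1) (hd₁ : m₁.natDegree = e₁ + 1) (hd₂ : m₂.natDegree = e₂ + 1)
    (ht : e₁ + e₂ + 2 ≤ t + 1) (b : K[X]) :
    sigNeg (hankelSq K t (dualSeq K (m₁ * m₂) b)).toQuadraticForm'
      = sigNeg (hankelSq K e₁ (dualSeq K m₁ (b * c₂))).toQuadraticForm' + sigNeg (hankelSq K e₂ (dualSeq K m₂ (b * c₁))).toQuadraticForm' := by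
  have hb : b = b * c₂ * m₂ + b * c₁ * m₁ := by
    calc b = b * (c₁ * m₁ + c₂ * m₂) := by rw [hcc, mul_one]
      _ = b * c₂ * m₂ + b * c₁ * m₁ := by ring
  conv_lhs => rw [hb]
  exact sigNeg_hankelSq_dualSeq_mul_of_isCoprime hm₁ hm₂ ⟨c₁, c₂, hcc⟩ hd₁ hd₂ ht (b * c₂) (b * c₁)

end OrderedCRT

/-! ## §725. Hermite's forms: `sigPos ∕ sigNeg ∕ rank` of `H(a·(m₁m₂)′/(m₁m₂))` are the sums over the coprime factors -/

/-- **The weighted symbol is a logarithmic derivative: `dualSeq (m₁m₂) (a·(m₁m₂)′) = dualSeq m₁ (a·m₁′) + dualSeq m₂ (a·m₂′)`** for monic `m₁`, `m₂` and any weight `a` (no coprimality;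
`a(m₁m₂)′/(m₁m₂) = a m₁′/m₁ + a m₂′/m₂`; the case `a = 1` is N118 `dualSeq_mul_derivative_mul`). [this file, §725] -/
theorem dualSeq_mul_mul_derivative_mul {m₁ m₂ : K[X]} (hm₁ : m₁.Monic) (hm₂ : m₂.Monic) (a : K[X]) :
    dualSeq K (m₁ * m₂) (a * derivative (m₁ * m₂)) = dualSeq K m₁ (a * derivative m₁) + dualSeq K m₂ (a * derivative m₂) := by
  rw [dualSeq_add_dualSeq K hm₁ hm₂, Polynomial.derivative_mul]
  congr 1
  ring

/-- Hence **`H_t(a(m₁m₂)′/(m₁m₂)) = H_t(a m₁′/m₁) + H_t(a m₂′/m₂)`** as matrices (any `t`, any field). [this file, §725] -/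
theorem hankelSq_dualSeq_mul_mul_derivative_mul {m₁ m₂ : K[X]} (hm₁ : m₁.Monic) (hm₂ : m₂.Monic) (a : K[X]) (t : ℕ) :
    hankelSq K t (dualSeq K (m₁ * m₂) (a * derivative (m₁ * m₂))) = hankelSq K t (dualSeq K m₁ (a * derivative m₁)) + hankelSq K t (dualSeq K m₂ (a * derivative m₂)) := by
  rw [dualSeq_mul_mul_derivative_mul K hm₁ hm₂]
  ext i j
  rw [Matrix.add_apply, hankelSq, hankelSq, hankelSq, Matrix.of_apply, Matrix.of_apply, Matrix.of_apply, Pi.add_apply]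

section OrderedHermite

variable {K} [LinearOrder K] [IsStrictOrderedRing K]

/-- **HERMITE'S SIGNATURE IS ADDITIVE OVER COPRIME FACTORISATIONS: for `m₁`, `m₂` monic coprime of degrees `e₁ + 1`, `e₂ + 1` over a linearly ordered field, any weight `a`, any size
`t + 1 ≥ deg(m₁m₂)`: `sigPos H_t(a(m₁m₂)′/(m₁m₂)) = sigPos H_{e₁}(a m₁′/m₁) + sigPos H_{e₂}(a m₂′/m₂)`.** Over a real closed field both sides count roots with the sign of `a` (N127 ∕ N128); the
present statement needs no roots at all. [this file, §725] -/
theorem sigPos_hankelSq_dualSeq_mul_derivative_of_isCoprime {e₁ e₂ t : ℕ} {m₁ m₂ : K[X]} (hm₁ : m₁.Monic) (hm₂ : m₂.Monic) (hc : IsCoprime m₁ m₂) (hd₁ : m₁.natDegree = e₁ + 1) (hd₂ : m₂.natDegree = e₂ + 1)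
    (ht : e₁ + e₂ + 2 ≤ t + 1) (a : K[X]) :
    sigPos (hankelSq K t (dualSeq K (m₁ * m₂) (a * derivative (m₁ * m₂)))).toQuadraticForm'
      = sigPos (hankelSq K e₁ (dualSeq K m₁ (a * derivative m₁))).toQuadraticForm' + sigPos (hankelSq K e₂ (dualSeq K m₂ (a * derivative m₂))).toQuadraticForm' := by
  rw [dualSeq_mul_mul_derivative_mul K hm₁ hm₂, sigPos_hankelSq_dualSeq_add_of_isCoprime hm₁ hm₂ hc hd₁ hd₂ ht]

/-- **`sigNeg H_t(a(m₁m₂)′/(m₁m₂)) = sigNeg H_{e₁}(a m₁′/m₁) + sigNeg H_{e₂}(a m₂′/m₂)`.** [this file, §725] -/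
theorem sigNeg_hankelSq_dualSeq_mul_derivative_of_isCoprime {e₁ e₂ t : ℕ} {m₁ m₂ : K[X]} (hm₁ : m₁.Monic) (hm₂ : m₂.Monic) (hc : IsCoprime m₁ m₂) (hd₁ : m₁.natDegree = e₁ + 1) (hd₂ : m₂.natDegree = e₂ + 1)
    (ht : e₁ + e₂ + 2 ≤ t + 1) (a : K[X]) :
    sigNeg (hankelSq K t (dualSeq K (m₁ * m₂) (a * derivative (m₁ * m₂)))).toQuadraticForm'
      = sigNeg (hankelSq K e₁ (dualSeq K m₁ (a * derivative m₁))).toQuadraticForm' + sigNeg (hankelSq K e₂ (dualSeq K m₂ (a * derivative m₂))).toQuadraticForm' := by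
  rw [dualSeq_mul_mul_derivative_mul K hm₁ hm₂, sigNeg_hankelSq_dualSeq_add_of_isCoprime hm₁ hm₂ hc hd₁ hd₂ ht]

/-- **Signature: `Sign H_t(a(m₁m₂)′/(m₁m₂)) = Sign H_{e₁}(a m₁′/m₁) + Sign H_{e₂}(a m₂′/m₂)`** (as integers `sigPos − sigNeg`; over a real closed field: `TaQ(a, m₁m₂) = TaQ(a, m₁) + TaQ(a, m₂)`, N129).
[this file, §725] -/
theorem sigPos_sub_sigNeg_hankelSq_dualSeq_mul_derivative_of_isCoprime {e₁ e₂ t : ℕ} {m₁ m₂ : K[X]} (hm₁ : m₁.Monic) (hm₂ : m₂.Monic) (hc : IsCoprime m₁ m₂) (hd₁ : m₁.natDegree = e₁ + 1)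
    (hd₂ : m₂.natDegree = e₂ + 1) (ht : e₁ + e₂ + 2 ≤ t + 1) (a : K[X]) :
    (sigPos (hankelSq K t (dualSeq K (m₁ * m₂) (a * derivative (m₁ * m₂)))).toQuadraticForm' : ℤ) - sigNeg (hankelSq K t (dualSeq K (m₁ * m₂) (a * derivative (m₁ * m₂)))).toQuadraticForm'
      = ((sigPos (hankelSq K e₁ (dualSeq K m₁ (a * derivative m₁))).toQuadraticForm' : ℤ) - sigNeg (hankelSq K e₁ (dualSeq K m₁ (a * derivative m₁))).toQuadraticForm')
        + ((sigPos (hankelSq K e₂ (dualSeq K m₂ (a * derivative m₂))).toQuadraticForm' : ℤ) - sigNeg (hankelSq K e₂ (dualSeq K m₂ (a * derivative m₂))).toQuadraticForm') := by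
  rw [sigPos_hankelSq_dualSeq_mul_derivative_of_isCoprime hm₁ hm₂ hc hd₁ hd₂ ht, sigNeg_hankelSq_dualSeq_mul_derivative_of_isCoprime hm₁ hm₂ hc hd₁ hd₂ ht]
  push_cast
  ring

/-- **Rank: `rank H_t(a(m₁m₂)′/(m₁m₂)) = rank H_{e₁}(a m₁′/m₁) + rank H_{e₂}(a m₂′/m₂)`** over an ordered field (over an algebraically closed field of characteristic `0` both sides count the roots off
`Zer(a)`, N113; here no roots are needed). [this file, §725] -/
theorem rank_hankelSq_dualSeq_mul_derivative_of_isCoprime {e₁ e₂ t : ℕ} {m₁ m₂ : K[X]} (hm₁ : m₁.Monic) (hm₂ : m₂.Monic) (hc : IsCoprime m₁ m₂) (hd₁ : m₁.natDegree = e₁ + 1) (hd₂ : m₂.natDegree = e₂ + 1)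
    (ht : e₁ + e₂ + 2 ≤ t + 1) (a : K[X]) :
    (hankelSq K t (dualSeq K (m₁ * m₂) (a * derivative (m₁ * m₂)))).rank = (hankelSq K e₁ (dualSeq K m₁ (a * derivative m₁))).rank + (hankelSq K e₂ (dualSeq K m₂ (a * derivative m₂))).rank := by
  rw [dualSeq_mul_mul_derivative_mul K hm₁ hm₂, rank_hankelSq_dualSeq_add_of_isCoprime hm₁ hm₂ hc hd₁ hd₂ ht]

/-- **The unweighted Hermite form (`a = 1`): `sigPos H_t((m₁m₂)′/(m₁m₂)) = sigPos H_{e₁}(m₁′/m₁) + sigPos H_{e₂}(m₂′/m₂)` and the same for `sigNeg`** — over a real closed field: the number of distinct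
real roots of a coprime product is the sum, and so is the number of pairs of complex-conjugate roots (N128: `sigNeg H(P′/P) = #pairs`). [this file, §725] -/
theorem sigPos_sigNeg_hankelSq_dualSeq_derivative_of_isCoprime {e₁ e₂ t : ℕ} {m₁ m₂ : K[X]} (hm₁ : m₁.Monic) (hm₂ : m₂.Monic) (hc : IsCoprime m₁ m₂) (hd₁ : m₁.natDegree = e₁ + 1) (hd₂ : m₂.natDegree = e₂ + 1)
    (ht : e₁ + e₂ + 2 ≤ t + 1) :
    sigPos (hankelSq K t (dualSeq K (m₁ * m₂) (derivative (m₁ * m₂)))).toQuadraticForm'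
        = sigPos (hankelSq K e₁ (dualSeq K m₁ (derivative m₁))).toQuadraticForm' + sigPos (hankelSq K e₂ (dualSeq K m₂ (derivative m₂))).toQuadraticForm'
      ∧ sigNeg (hankelSq K t (dualSeq K (m₁ * m₂) (derivative (m₁ * m₂)))).toQuadraticForm'
        = sigNeg (hankelSq K e₁ (dualSeq K m₁ (derivative m₁))).toQuadraticForm' + sigNeg (hankelSq K e₂ (dualSeq K m₂ (derivative m₂))).toQuadraticForm' := by
  have h1 := sigPos_hankelSq_dualSeq_mul_derivative_of_isCoprime hm₁ hm₂ hc hd₁ hd₂ ht 1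
  have h2 := sigNeg_hankelSq_dualSeq_mul_derivative_of_isCoprime hm₁ hm₂ hc hd₁ hd₂ ht 1
  simp only [one_mul] at h1 h2
  exact ⟨h1, h2⟩

/-- **A factor whose Hermite form has no negative square is INVISIBLE to `sigNeg`: if `sigNeg H_{e₁}(a m₁′/m₁) = 0` (e.g. `m₁` split with `a ≥ 0` on its roots, N127) then
`sigNeg H_t(a(m₁m₂)′/(m₁m₂)) = sigNeg H_{e₂}(a m₂′/m₂)`** — the negative index of the Hermite form only sees the cofactor. [this file, §725] -/
theorem sigNeg_hankelSq_dualSeq_mul_derivative_eq_of_sigNeg_eq_zero {e₁ e₂ t : ℕ} {m₁ m₂ : K[X]} (hm₁ : m₁.Monic) (hm₂ : m₂.Monic) (hc : IsCoprime m₁ m₂) (hd₁ : m₁.natDegree = e₁ + 1)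
    (hd₂ : m₂.natDegree = e₂ + 1) (ht : e₁ + e₂ + 2 ≤ t + 1) {a : K[X]} (h0 : sigNeg (hankelSq K e₁ (dualSeq K m₁ (a * derivative m₁))).toQuadraticForm' = 0) :
    sigNeg (hankelSq K t (dualSeq K (m₁ * m₂) (a * derivative (m₁ * m₂)))).toQuadraticForm' = sigNeg (hankelSq K e₂ (dualSeq K m₂ (a * derivative m₂))).toQuadraticForm' := by
  rw [sigNeg_hankelSq_dualSeq_mul_derivative_of_isCoprime hm₁ hm₂ hc hd₁ hd₂ ht, h0, zero_add]

end OrderedHermite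

end Summit.Ventures.HSemireg.Wedge.HankelOuter
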